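import Summits.Ventures.PercRepro.C041PendantCounts
import Summits.Ventures.PercRepro.C041TreeZoneBridgeIso
import Summits.Ventures.PercRepro.C041ZoneOneVertexMain

/-!
# ROW C-041 — the class 𝒵: seeds for the pendant attachment, and the invariant (P) on zones given up to
isomorphism (p6, gen 29; C-041.md §20 (b)(3))

THEOREM (PENDANT ZONE) (`C041PendantCounts`: `K4_pendant`) propagates the invariant (P) — `K4` of the four
one-anchor counts — through every pendant attachment.  Its SEEDS are the zones on which (P) is already a kernel
theorem: every tree zone (`TZ.K4_toZone`, from mine-3's `K4_counts` through the dictionary of `C041TreeZoneBridge`)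
and every zone whose marks sit at one vertex (`K4_oneVertex`, from mine-3's `oneVertex_cs` / `card_Iset_le_card_Fset_ov`,
`C041ZoneOneVertexMain`); (P) transports along zone isomorphisms (`ZoneIso.K4_iff`, `C041ZoneIso`).  Hence the
one-anchor (CS) and the ZONE O-CUBE hold on every zone obtained from these seeds by iterated pendant attachments at
vertices of unmarked multigraphs — the class 𝒵 of C-041.md §20 (b)(3) — attachment by attachment
(`zoneOCubeConj_pendant_tree`, `zoneOCubeConj_pendant_oneVertex` are the first two steps).
-/

namespace PercRepro

namespace ZoneZ

open ZoneData TreeClosure Pendant Finset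

variable {V E T₁ T₂ : Type*} (Z : ZoneData V E T₁ T₂) [Fintype E] [DecidableEq E] [Fintype T₁] [DecidableEq T₁]
  [Fintype T₂] [DecidableEq T₂] (k : V)

/-- The invariant (P) from its count form: `#I ≤ #F` and `(#F − #I)² ≤ #T₁·#T₂`. -/
theorem K4_of_cs_counts (hle : #(Z.Iset k) ≤ #(Z.Fset k))
    (hcs : (#(Z.Fset k) - #(Z.Iset k)) ^ 2 ≤ #(Z.T1set k) * #(Z.T2set k)) :
    K4 (#(Z.Fset k) : ℝ) (#(Z.T1set k)) (#(Z.T2set k)) (#(Z.Iset k)) where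
  t1_nonneg := Nat.cast_nonneg _
  t2_nonneg := Nat.cast_nonneg _
  k_nonneg := Nat.cast_nonneg _
  k_le_g := by exact_mod_cast hle
  cs := by
    have h : ((#(Z.Fset k) - #(Z.Iset k) : ℕ) : ℝ) ^ 2 ≤ ((#(Z.T1set k) * #(Z.T2set k) : ℕ) : ℝ) := by
      exact_mod_cast hcs
    rw [Nat.cast_sub hle] at h
    push_cast at h
    exact h

/-- **SEED: one-vertex zones satisfy (P)** (mine-3's THEOREM (ONE MARKED VERTEX), `C041ZoneOneVertexMain`). -/
theorem K4_oneVertex (v : V) (h1 : ∀ i, Z.at₁ i = v) (h2 : ∀ j, Z.at₂ j = v) :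
    K4 (#(Z.Fset k) : ℝ) (#(Z.T1set k)) (#(Z.T2set k)) (#(Z.Iset k)) :=
  K4_of_cs_counts Z k (Z.card_Iset_le_card_Fset_ov k v h1 h2) (Z.oneVertex_cs k v h1 h2)

/-- **(P) transports along a zone isomorphism.** -/
theorem ZoneIso.K4_iff {V' E' T₁' T₂' : Type*} {Z' : ZoneData V' E' T₁' T₂'} [Fintype E'] [DecidableEq E']
    [Fintype T₁'] [DecidableEq T₁'] [Fintype T₂'] [DecidableEq T₂'] (φ : ZoneIso Z Z') :
    K4 (#(Z'.Fset (φ.v k)) : ℝ) (#(Z'.T1set (φ.v k))) (#(Z'.T2set (φ.v k))) (#(Z'.Iset (φ.v k))) ↔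
      K4 (#(Z.Fset k) : ℝ) (#(Z.T1set k)) (#(Z.T2set k)) (#(Z.Iset k)) := by
  rw [φ.card_Fset, φ.card_T1set, φ.card_T2set, φ.card_Iset]

end ZoneZ

namespace TreeClosure

open ZoneZ ZoneZ.ZoneData ZoneZ.Pendant Finset

/-- **SEED: tree zones satisfy (P)** (mine-3's `K4_counts` through the dictionary). -/
theorem TZ.K4_toZone (t : TZ) :
    K4 (#(t.toZone.Fset t.root) : ℝ) (#(t.toZone.T1set t.root)) (#(t.toZone.T2set t.root))
      (#(t.toZone.Iset t.root)) := by
  rw [t.card_Fset, t.card_T1set, t.card_T2set, t.card_Iset]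
  exact K4_counts t

variable {V₁ E₁ U₁ U₂ : Type*} (Z₁ : ZoneData V₁ E₁ U₁ U₂) (u a : V₁) [Fintype E₁] [DecidableEq E₁]

/-- **A tree zone hung at any vertex of any unmarked multigraph**: the ZONE O-CUBE holds. -/
theorem zoneOCubeConj_pendant_tree (t : TZ) :
    (pendant Z₁ u t.toZone t.root).ZoneOCubeConj {Sum.inl a} (∅ : Set (V₁ ⊕ t.Pos)) :=
  zoneOCubeConj_pendant Z₁ u t.toZone t.root a t.K4_toZone

/-- **A tree zone hung at any vertex of any unmarked multigraph**: the one-anchor (CS) holds. -/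
theorem zoneCSConj_pendant_tree (t : TZ) :
    (pendant Z₁ u t.toZone t.root).ZoneCSConj {Sum.inl a} (∅ : Set (V₁ ⊕ t.Pos)) :=
  zoneCSConj_pendant Z₁ u t.toZone t.root a t.K4_toZone

end TreeClosure

namespace ZoneZ

open ZoneData TreeClosure Pendant Finset

variable {V₁ E₁ U₁ U₂ V₂ E₂ T₁ T₂ : Type*} (Z₁ : ZoneData V₁ E₁ U₁ U₂) (u a : V₁) (Z₂ : ZoneData V₂ E₂ T₁ T₂)
  (a₂ v : V₂) [Fintype E₁] [DecidableEq E₁] [Fintype E₂] [DecidableEq E₂] [Fintype T₁] [DecidableEq T₁]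
  [Fintype T₂] [DecidableEq T₂]

/-- **A one-vertex zone hung at any vertex of any unmarked multigraph**: the ZONE O-CUBE holds. -/
theorem zoneOCubeConj_pendant_oneVertex (h1 : ∀ i, Z₂.at₁ i = v) (h2 : ∀ j, Z₂.at₂ j = v) :
    (pendant Z₁ u Z₂ a₂).ZoneOCubeConj {Sum.inl a} (∅ : Set (V₁ ⊕ V₂)) :=
  zoneOCubeConj_pendant Z₁ u Z₂ a₂ a (K4_oneVertex Z₂ a₂ v h1 h2)

/-- **Iteration**: the pendant of a pendant satisfies (P) again — the induction step of the class 𝒵. -/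
theorem K4_pendant_pendant {V₀ E₀ U₀ U₀' : Type*} (Z₀ : ZoneData V₀ E₀ U₀ U₀') (u₀ a₀ : V₀) [Fintype E₀]
    [DecidableEq E₀] (h : K4 (#(Z₂.Fset a₂) : ℝ) (#(Z₂.T1set a₂)) (#(Z₂.T2set a₂)) (#(Z₂.Iset a₂))) :
    K4 (#((pendant Z₀ u₀ (pendant Z₁ u Z₂ a₂) (Sum.inl a)).Fset (Sum.inl a₀)) : ℝ)
      (#((pendant Z₀ u₀ (pendant Z₁ u Z₂ a₂) (Sum.inl a)).T1set (Sum.inl a₀)))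
      (#((pendant Z₀ u₀ (pendant Z₁ u Z₂ a₂) (Sum.inl a)).T2set (Sum.inl a₀)))
      (#((pendant Z₀ u₀ (pendant Z₁ u Z₂ a₂) (Sum.inl a)).Iset (Sum.inl a₀))) :=
  K4_pendant Z₀ u₀ _ _ a₀ (K4_pendant Z₁ u Z₂ a₂ a h)

end ZoneZ

end PercRepro
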